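import Mathlib
import HarnessLib
import Summits.NavierStokesRegularity.NavierStokesRegularity.Theorems.LocalSineTubeDoorMostTimesGenericDoor
import Summits.NavierStokesRegularity.NavierStokesRegularity.Theorems.LocalHelicityTubeDoorFrobeniusWindowRigidityWindow

/-!
# Door S11 `LocalTubeDoorHelicity` (nsreg-p1 ROUND-11/12, unstaged) — the MOST-TIMES form of the door, CONDITIONAL on
# its profile crux K2⁗ (window form) / `FrobeniusProfileRigidity` (slab form)

Cell ns-regularity-ideate, seat p6 (route-directed support for an unstaged door; anchor
`--supports stmt-NavierStokesRegularity-20018`, edge re-pointed at birth).  Companion of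
`…LocalHelicityTubeDoorTarget.localTubeDoorHelicity_of_windowRigidity` (S11 ⇐ K2⁗, all times): with the most-times
template `…MostTimesGenericDoor.mostTimesGenericDoor_of_profileWindowRigidity` the SAME crux yields the stronger
MOST-TIMES door — the scale-normalised helicity density `(T−t)^{3/2} u·curl u` need only fade in `L¹` on one similarity
window along times outside an exceptional set of density `→ 0` at `T`
(`mostTimesHelicityDoor_of_windowRigidity`, `mostTimesHelicityDoor_of_profileRigidity`).

SUPPORT EDGE (route-NavierStokesRegularity-LocalHelicityTubeDoor born; director-ns g6 #1 (5)): this file is re-pointed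
`--supports stmt-NavierStokesRegularity-19975 --as helper` (nsreg-p6 g5 p464575: most-times S11 door ⇐ K2⁗ (director-ns g6 #1 (5) lists it with the K2⁗ item)); it was parked on the
CLOSED fallback anchor stmt-NavierStokesRegularity-20018 while the route was unborn.  Declarations unchanged.

WHAT THIS IS NOT: not a claim about Navier–Stokes regularity (Clay A) and not progress on K2⁗ — a conditional
strengthening of an unstaged door (a LOCAL criterion conditional on local Type I AND on the open profile crux), bears_on
LADDER-NS N0.
-/

noncomputable section

-- the summit and its single sub-problem share the name (CONVENTIONS §1), as in every Theorems file
set_option linter.dupNamespace false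

namespace Summit.NavierStokesRegularity.NavierStokesRegularity.Theorems.LocalHelicityTubeDoorMostTimesDoor

open MeasureTheory Set Function Filter Topology TopologicalSpace Metric
open scoped RealInnerProductSpace InnerProductSpace NNReal ENNReal
open Literature.Analysis Literature.Analysis.FluidPDE
open Summit.NavierStokesRegularity.NavierStokesRegularity.Theorems.LocalSineTubeDoorMostTimesGenericDoor
open Summit.NavierStokesRegularity.NavierStokesRegularity.Theorems.LocalHelicityTubeDoorFrobeniusWindowRigidityWindow

/-- `F(x, A) = ⟪x, curlCLM A⟫` is continuous. -/
theorem continuous_helicityScalar :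
    Continuous fun q : EuclideanSpace ℝ (Fin 3) × (EuclideanSpace ℝ (Fin 3) →L[ℝ] EuclideanSpace ℝ (Fin 3)) =>
      ⟪q.1, curlCLM q.2⟫_ℝ :=
  continuous_fst.inner (curlCLM.continuous.comp continuous_snd)

/-- The zero set of `F(x, A) = ⟪x, curlCLM A⟫` is invariant under positive rescalings. -/
theorem helicityScalar_zeroSet_invariant :
    ∀ (a b : ℝ), 0 < a → 0 < b → ∀ (x : EuclideanSpace ℝ (Fin 3))
      (A : EuclideanSpace ℝ (Fin 3) →L[ℝ] EuclideanSpace ℝ (Fin 3)),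
      ⟪a • x, curlCLM (b • A)⟫_ℝ = 0 ↔ ⟪x, curlCLM A⟫_ℝ = 0 := by
  intro a b ha hb x A
  rw [map_smul, real_inner_smul_left, real_inner_smul_right, mul_eq_zero, mul_eq_zero, or_iff_right ha.ne',
    or_iff_right hb.ne']

/-- **THE MOST-TIMES HELICITY DOOR ⇐ K2⁗ (window form).**  If every profile of the Type-I class whose helicity density
vanishes on a nonempty open window of every slice is not backward-singular, then for a classical Leray–Hopf solution on
`[0,T)` from rapidly decaying data, LOCALLY Type I at `(x₀,T)`, a nonempty open window `U` and an exceptional time set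
`E` with `|E ∩ (T−h,T)| ≤ εh` for all small `h` (every `ε > 0`): if
`∫_U |√(T−tₖ)³ ⟪u, curl u⟫(tₖ, x₀+√(T−tₖ)y)| dy → 0` along EVERY sequence `tₖ → T` in `[0,T) ∖ E`, then `u` is backward
bounded at `x₀`. -/
theorem mostTimesHelicityDoor_of_windowRigidity
    (h₂ : ∀ (C : ℝ) (v : ℝ → EuclideanSpace ℝ (Fin 3) → EuclideanSpace ℝ (Fin 3)),
      Literature.Analysis.FluidPDE.HasTypeITimeDecay C v →
      ContinuousOn (Function.uncurry v) (Set.Iio (0 : ℝ) ×ˢ Set.univ) →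
      (∀ s t : ℝ, s < t → t < 0 → ∀ x, v t x =
        Literature.Analysis.UnboundedOperators.heatExtension (v s) (t - s) x -
          Literature.Analysis.FluidPDE.oseenDuhamel 1 s v v t x) →
      (∀ t < 0, Literature.Analysis.FluidPDE.VectorCalculus.IsDivFree (v t)) →
      (∀ s < 0, ∃ U : Set (EuclideanSpace ℝ (Fin 3)), IsOpen U ∧ U.Nonempty ∧
        ∀ y ∈ U, ⟪v s y, Literature.Analysis.FluidPDE.curl (v s) y⟫_ℝ = 0) →
      ¬ Literature.Analysis.FluidPDE.IsBackwardSingularPoint v 0) :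
    ∀ (ν T : ℝ), 0 < ν → 0 < T → ∀ (u : ℝ → EuclideanSpace ℝ (Fin 3) → EuclideanSpace ℝ (Fin 3))
      (p : ℝ → EuclideanSpace ℝ (Fin 3) → ℝ),
    Literature.Analysis.FluidPDE.IsClassicalNSSolutionOn (Set.Ico 0 T) ν 0 u p →
    Literature.Analysis.FluidPDE.IsLerayHopfOn T ν 0 (u 0) u →
    Literature.Analysis.FluidPDE.HasRapidSpatialDecay (u 0) →
    ∀ (x₀ : EuclideanSpace ℝ (Fin 3)) (ρ M : ℝ), 0 < ρ →
    (∀ t ∈ Set.Ico 0 T, T - ρ ^ 2 < t → ∀ x ∈ Metric.ball x₀ ρ, ‖u t x‖ * Real.sqrt (ν * (T - t)) ≤ M) →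
    ∀ (U : Set (EuclideanSpace ℝ (Fin 3))), IsOpen U → U.Nonempty →
    ∀ (E : Set ℝ), (∀ ε > 0, ∀ᶠ h in nhdsWithin (0 : ℝ) (Set.Ioi 0),
      MeasureTheory.volume (E ∩ Set.Ioo (T - h) T) ≤ ENNReal.ofReal (ε * h)) →
    (∀ t : ℕ → ℝ, (∀ k, t k ∈ Set.Ico 0 T ∧ t k ∉ E) → Filter.Tendsto t Filter.atTop (nhds T) →
      Filter.Tendsto (fun k => ∫⁻ y in U, ENNReal.ofReal
        |Real.sqrt (T - t k) ^ 3 * ⟪u (t k) (x₀ + Real.sqrt (T - t k) • y),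
          Literature.Analysis.FluidPDE.curl (u (t k)) (x₀ + Real.sqrt (T - t k) • y)⟫_ℝ|) Filter.atTop (nhds 0)) →
    Literature.Analysis.FluidPDE.IsBackwardBoundedAt u T x₀ := by
  intro ν T hν hT u p hsol hLH hdec x₀ ρ M hρ hM U hU hUne E hE hfadeE
  have hcrux : ∀ (C : ℝ) (v : ℝ → EuclideanSpace ℝ (Fin 3) → EuclideanSpace ℝ (Fin 3)),
      Literature.Analysis.FluidPDE.HasTypeITimeDecay C v →
      ContinuousOn (Function.uncurry v) (Set.Iio (0 : ℝ) ×ˢ Set.univ) →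
      (∀ s t : ℝ, s < t → t < 0 → ∀ x, v t x =
        Literature.Analysis.UnboundedOperators.heatExtension (v s) (t - s) x -
          Literature.Analysis.FluidPDE.oseenDuhamel 1 s v v t x) →
      (∀ t < 0, Literature.Analysis.FluidPDE.VectorCalculus.IsDivFree (v t)) →
      (∀ s < 0, ∃ U : Set (EuclideanSpace ℝ (Fin 3)), IsOpen U ∧ U.Nonempty ∧
        ∀ z ∈ U, (fun (x : EuclideanSpace ℝ (Fin 3)) (A : EuclideanSpace ℝ (Fin 3) →L[ℝ] EuclideanSpace ℝ (Fin 3)) =>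
          ⟪x, curlCLM A⟫_ℝ) (v s z) (fderiv ℝ (v s) z) = 0) →
      ¬ Literature.Analysis.FluidPDE.IsBackwardSingularPoint v 0 := by
    intro C v hrate hcont hmild hdiv hwin
    refine h₂ C v hrate hcont hmild hdiv fun s hs => ?_
    obtain ⟨U', hU', hne', hal⟩ := hwin s hs
    exact ⟨U', hU', hne', fun y hy => by rw [curl_eq_curlCLM]; exact hal y hy⟩
  refine mostTimesGenericDoor_of_profileWindowRigidity (fun x A => ⟪x, curlCLM A⟫_ℝ) continuous_helicityScalar
    helicityScalar_zeroSet_invariant hcrux ν T hν hT u p hsol hLH hdec x₀ ρ M hρ hM U hU hUne E hE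
    fun t htk htT => ?_
  refine (hfadeE t htk htT).congr fun k => ?_
  refine lintegral_congr fun y => ?_
  rw [map_smul, ← curl_eq_curlCLM, real_inner_smul_left, real_inner_smul_right]
  ring_nf

/-- **THE MOST-TIMES HELICITY DOOR ⇐ `FrobeniusProfileRigidity` (slab form)** — via the tree's window → slab theorem
`…FrobeniusWindowRigidityWindow.frobeniusWindowRigidity_of_profileRigidity`. -/
theorem mostTimesHelicityDoor_of_profileRigidity
    (hprofile : ∀ (C : ℝ) (v : ℝ → EuclideanSpace ℝ (Fin 3) → EuclideanSpace ℝ (Fin 3)),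
      Literature.Analysis.FluidPDE.HasTypeITimeDecay C v →
      ContinuousOn (Function.uncurry v) (Set.Iio (0 : ℝ) ×ˢ Set.univ) →
      (∀ s t : ℝ, s < t → t < 0 → ∀ x, v t x =
        Literature.Analysis.UnboundedOperators.heatExtension (v s) (t - s) x -
          Literature.Analysis.FluidPDE.oseenDuhamel 1 s v v t x) →
      (∀ t < 0, Literature.Analysis.FluidPDE.VectorCalculus.IsDivFree (v t)) →
      (∀ s < 0, ∀ y : EuclideanSpace ℝ (Fin 3), ⟪v s y, Literature.Analysis.FluidPDE.curl (v s) y⟫_ℝ = 0) →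
      ¬ Literature.Analysis.FluidPDE.IsBackwardSingularPoint v 0) :
    ∀ (ν T : ℝ), 0 < ν → 0 < T → ∀ (u : ℝ → EuclideanSpace ℝ (Fin 3) → EuclideanSpace ℝ (Fin 3))
      (p : ℝ → EuclideanSpace ℝ (Fin 3) → ℝ),
    Literature.Analysis.FluidPDE.IsClassicalNSSolutionOn (Set.Ico 0 T) ν 0 u p →
    Literature.Analysis.FluidPDE.IsLerayHopfOn T ν 0 (u 0) u →
    Literature.Analysis.FluidPDE.HasRapidSpatialDecay (u 0) →
    ∀ (x₀ : EuclideanSpace ℝ (Fin 3)) (ρ M : ℝ), 0 < ρ →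
    (∀ t ∈ Set.Ico 0 T, T - ρ ^ 2 < t → ∀ x ∈ Metric.ball x₀ ρ, ‖u t x‖ * Real.sqrt (ν * (T - t)) ≤ M) →
    ∀ (U : Set (EuclideanSpace ℝ (Fin 3))), IsOpen U → U.Nonempty →
    ∀ (E : Set ℝ), (∀ ε > 0, ∀ᶠ h in nhdsWithin (0 : ℝ) (Set.Ioi 0),
      MeasureTheory.volume (E ∩ Set.Ioo (T - h) T) ≤ ENNReal.ofReal (ε * h)) →
    (∀ t : ℕ → ℝ, (∀ k, t k ∈ Set.Ico 0 T ∧ t k ∉ E) → Filter.Tendsto t Filter.atTop (nhds T) →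
      Filter.Tendsto (fun k => ∫⁻ y in U, ENNReal.ofReal
        |Real.sqrt (T - t k) ^ 3 * ⟪u (t k) (x₀ + Real.sqrt (T - t k) • y),
          Literature.Analysis.FluidPDE.curl (u (t k)) (x₀ + Real.sqrt (T - t k) • y)⟫_ℝ|) Filter.atTop (nhds 0)) →
    Literature.Analysis.FluidPDE.IsBackwardBoundedAt u T x₀ :=
  mostTimesHelicityDoor_of_windowRigidity (frobeniusWindowRigidity_of_profileRigidity hprofile)

end Summit.NavierStokesRegularity.NavierStokesRegularity.Theorems.LocalHelicityTubeDoorMostTimesDoor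

end
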